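import Literature.Barriers.CriticalPhenomena.GaussianDominationRouteImprovement
import Mathlib.Algebra.Order.ToIntervalMod
import HarnessLib

/-!
# Towards `HaraSlade1990_infraredBound_holds`, IV: Slade's trigonometric lemma (HvdH Lemma 8.2),
# a Cauchy–Schwarz inequality for lattice sums, and reduction of momenta to the Brillouin zone

Sibling proof file of `GaussianDominationRoute{Bootstrap,Continuity,Improvement}.lean` (barrier
catalogue `Literature/Barriers/CriticalPhenomena/`): tools for the derivation of
`HvdH2017_lemma812` (the `f₃`-improvement) from `HvdH2017_prop83`.

* **Lemma 8.2** (Slade [246, Lemma 5.7]; HvdH (8.2.19)–(8.2.30)): for a summable `a : ℤ^d → ℝ`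
  with `â = cosFT a` and `Â = 1/(1 - â)` positive at `l`, `l ± k`,
  `|Δ_k Â(l)| ≤ (Â(l-k) + Â(l+k)) Â(l) Bₐ(k) + 8 Â(l-k)Â(l)Â(l+k) Bₐ(l) Bₐ(k)` with
  `Bₐ(m) = |â|(0) - |â|(m) = Σ_x [1 - cos(m·x)] |a(x)|` (`slade_lemma82`). With the cosine
  transform the symmetry hypothesis `a(x) = a(-x)` of the printed lemma is not needed: the
  identities `â^{cos}(l,k) = [â(l-k) + â(l+k)]/2`, `â^{sin}(l,k) = [â(l-k) - â(l+k)]/2`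
  ((8.2.22)–(8.2.23)) hold for every summable `a`, so `Δ_k Â(l)` is a rational function of
  `â(l), â(l±k)` ((8.2.25)–(8.2.28), `secondDiff_inv_one_sub`), and the two bounds (8.2.29)
  (`abs_cosFT_sub_cosCos_le`) and (8.2.30) (`sinSin_sq_le`) finish the proof;
* the **Cauchy–Schwarz inequality for weighted lattice sums** `(Σ w|u||v|)² ≤ (Σ w u²)(Σ w v²)`
  (`tsum_mul_abs_mul_abs_le`), used in (8.2.30);
* **reduction to the Brillouin zone**: every momentum `m ∈ ℝ^d` has a representative
  `m' ∈ [-π,π]^d` with `cos(m'·x) = cos(m·x)` for all `x ∈ ℤ^d` and `cos(m'ⱼ) = cos(mⱼ)`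
  (`exists_mem_cube_cos_kdot_eq`), so `cosFT f`, `τ̂_p`, `D̂` take at `m` values taken on the
  cube (`exists_mem_cube_cosFT_eq`); in particular the bootstrap bound
  `τ̂_p(m)/Ĉ_{λ_p}(m) ≤ f₂(p)` holds for all `m` (`tauHat_div_Chat_le_bootF2`).

## References

* M. Heydenreich, R. van der Hofstad, *Progress in High-Dimensional Percolation and Random
  Graphs* (Springer 2017), Lemma 8.2 and (8.2.19)–(8.2.30).
* G. Slade, *The Lace Expansion and its Applications*, LNM 1879 (2006), Lemma 5.7.
-/

noncomputable section

namespace Literature.Barriers.CriticalPhenomena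

open MeasureTheory Filter Topology Literature.Probability.LatticeModels Literature.Probability.Percolation
open scoped BigOperators

variable {d : ℕ}

/-! ### Cauchy–Schwarz for weighted lattice sums -/

/-- **Cauchy–Schwarz for weighted sums**: `Σ w |u||v| ≤ √(Σ w u²) √(Σ w v²)` for `w ≥ 0` (all
three families summable). Proof: `2t|u||v| ≤ t²u² + v²`, so `2X ≤ tU + V/t` for every `t > 0`;
optimise. [folklore] -/
theorem tsum_mul_abs_mul_abs_le {ι : Type*} {w u v : ι → ℝ} (hw : ∀ i, 0 ≤ w i)
    (hu : Summable fun i => w i * u i ^ 2) (hv : Summable fun i => w i * v i ^ 2)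
    (huv : Summable fun i => w i * (|u i| * |v i|)) :
    ∑' i, w i * (|u i| * |v i|) ≤
      Real.sqrt (∑' i, w i * u i ^ 2) * Real.sqrt (∑' i, w i * v i ^ 2) := by
  set U := ∑' i, w i * u i ^ 2 with hU
  set V := ∑' i, w i * v i ^ 2 with hV
  set X := ∑' i, w i * (|u i| * |v i|) with hX
  have hU0 : 0 ≤ U := tsum_nonneg fun i => mul_nonneg (hw i) (sq_nonneg _)
  have hV0 : 0 ≤ V := tsum_nonneg fun i => mul_nonneg (hw i) (sq_nonneg _)
  have hX0 : 0 ≤ X := tsum_nonneg fun i => mul_nonneg (hw i) (by positivity)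
  have key : ∀ t : ℝ, 0 < t → 2 * X ≤ t * U + V / t := by
    intro t ht
    have hpt : ∀ i, 2 * (w i * (|u i| * |v i|)) ≤ t * (w i * u i ^ 2) + (w i * v i ^ 2) / t := by
      intro i
      have h1 : 2 * t * (|u i| * |v i|) ≤ t ^ 2 * u i ^ 2 + v i ^ 2 := by
        nlinarith [sq_nonneg (t * |u i| - |v i|), sq_abs (u i), sq_abs (v i)]
      have h2 : 2 * (|u i| * |v i|) ≤ t * u i ^ 2 + v i ^ 2 / t := by
        rw [← sub_nonneg]
        have e : t * u i ^ 2 + v i ^ 2 / t - 2 * (|u i| * |v i|) =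
            (t ^ 2 * u i ^ 2 + v i ^ 2 - 2 * t * (|u i| * |v i|)) / t := by
          field_simp
        rw [e]
        exact div_nonneg (by linarith) ht.le
      have h3 := mul_le_mul_of_nonneg_left h2 (hw i)
      have e2 : w i * (t * u i ^ 2 + v i ^ 2 / t) = t * (w i * u i ^ 2) + (w i * v i ^ 2) / t := by
        ring
      linarith [e2]
    calc 2 * X = ∑' i, 2 * (w i * (|u i| * |v i|)) := by rw [tsum_mul_left]
      _ ≤ ∑' i, (t * (w i * u i ^ 2) + (w i * v i ^ 2) / t) :=
          Summable.tsum_le_tsum hpt (huv.mul_left 2) ((hu.mul_left t).add (hv.div_const t))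
      _ = t * U + V / t := by
          rw [(hu.mul_left t).tsum_add (hv.div_const t), tsum_mul_left, tsum_div_const]
  rcases hU0.eq_or_lt with hU00 | hUpos
  · -- `U = 0`: then `X = 0`
    have hX : X ≤ 0 := by
      by_contra hcon
      push Not at hcon
      have h := key ((V + 1) / X) (by positivity)
      rw [← hU00, mul_zero, zero_add, div_div_eq_mul_div] at h
      have h2 : V * X / (V + 1) ≤ X := by
        rw [div_le_iff₀ (by positivity)]; nlinarith
      linarith
    rw [← hU00, Real.sqrt_zero, zero_mul]
    exact hX
  rcases hV0.eq_or_lt with hV00 | hVpos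
  · have hX : X ≤ 0 := by
      by_contra hcon
      push Not at hcon
      have h := key (X / (U + 1)) (by positivity)
      rw [← hV00, zero_div, add_zero] at h
      have h2 : X / (U + 1) * U ≤ X := by
        rw [div_mul_eq_mul_div, div_le_iff₀ (by positivity)]; nlinarith
      linarith
    rw [← hV00, Real.sqrt_zero, mul_zero]
    exact hX
  · have hsU := Real.sqrt_pos.2 hUpos
    have hsV := Real.sqrt_pos.2 hVpos
    have h := key (Real.sqrt V / Real.sqrt U) (by positivity)
    have hUe : Real.sqrt U * Real.sqrt U = U := Real.mul_self_sqrt hUpos.le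
    have hVe : Real.sqrt V * Real.sqrt V = V := Real.mul_self_sqrt hVpos.le
    have e1 : Real.sqrt V / Real.sqrt U * U = Real.sqrt U * Real.sqrt V := by
      calc Real.sqrt V / Real.sqrt U * U
          = Real.sqrt V / Real.sqrt U * (Real.sqrt U * Real.sqrt U) := by rw [hUe]
        _ = Real.sqrt V / Real.sqrt U * Real.sqrt U * Real.sqrt U := by rw [mul_assoc]
        _ = Real.sqrt V * Real.sqrt U := by rw [div_mul_cancel₀ _ hsU.ne']
        _ = Real.sqrt U * Real.sqrt V := mul_comm _ _
    have e2 : V / (Real.sqrt V / Real.sqrt U) = Real.sqrt U * Real.sqrt V := by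
      rw [div_div_eq_mul_div]
      calc V * Real.sqrt U / Real.sqrt V
          = Real.sqrt V * Real.sqrt V * Real.sqrt U / Real.sqrt V := by rw [hVe]
        _ = Real.sqrt V * (Real.sqrt V * Real.sqrt U / Real.sqrt V) := by
            rw [mul_assoc, mul_div_assoc]
        _ = Real.sqrt V * Real.sqrt U := by rw [mul_div_cancel_left₀ _ hsV.ne']
        _ = Real.sqrt U * Real.sqrt V := mul_comm _ _
    rw [e1, e2] at h
    linarith

/-! ### The cosine transform at `l ± k` -/

section CosFT

variable {a : Site d → ℝ} (hs : Summable a)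
include hs

/-- `â(l-k) + â(l+k) = 2 Σ_x a(x) cos(l·x) cos(k·x)` (`= 2 â^{cos}(l,k)`, (8.2.22)). [cite: HeydenreichVanDerHofstad2017, (8.2.22)] -/
theorem cosFT_sub_add_cosFT_add (k l : Fin d → ℝ) :
    cosFT a (l - k) + cosFT a (l + k) =
      2 * ∑' x, a x * (Real.cos (kdot l x) * Real.cos (kdot k x)) := by
  rw [cosFT, cosFT, ← (summable_cos_kdot_mul hs (l - k)).tsum_add (summable_cos_kdot_mul hs (l + k)),
    ← tsum_mul_left]
  refine tsum_congr fun x => ?_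
  rw [kdot_sub_left, kdot_add_left, Real.cos_sub, Real.cos_add]
  ring

/-- `â(l-k) - â(l+k) = 2 Σ_x a(x) sin(l·x) sin(k·x)` (`= 2 â^{sin}(l,k)`, (8.2.23)). [cite: HeydenreichVanDerHofstad2017, (8.2.23)] -/
theorem cosFT_sub_sub_cosFT_add (k l : Fin d → ℝ) :
    cosFT a (l - k) - cosFT a (l + k) =
      2 * ∑' x, a x * (Real.sin (kdot l x) * Real.sin (kdot k x)) := by
  rw [cosFT, cosFT, ← (summable_cos_kdot_mul hs (l - k)).tsum_sub (summable_cos_kdot_mul hs (l + k)),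
    ← tsum_mul_left]
  refine tsum_congr fun x => ?_
  rw [kdot_sub_left, kdot_add_left, Real.cos_sub, Real.cos_add]
  ring

/-- The summable families behind `â^{cos}`, `â^{sin}` and (8.2.29): `a·g` is summable for
bounded `g`. [folklore] -/
theorem summable_mul_of_abs_le {g : Site d → ℝ} (C : ℝ) (hg : ∀ x, |g x| ≤ C) :
    Summable fun x => a x * g x :=
  Summable.of_norm_bounded (hs.norm.mul_left C) fun x => by
    rw [Real.norm_eq_abs, abs_mul, Real.norm_eq_abs, mul_comm C]
    exact mul_le_mul_of_nonneg_left (hg x) (abs_nonneg _)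

/-- `x ↦ [1 - cos(m·x)] |a(x)|` is summable. [folklore] -/
theorem summable_one_sub_cos_mul_abs (m : Fin d → ℝ) :
    Summable fun x => (1 - Real.cos (kdot m x)) * |a x| :=
  Summable.of_norm_bounded (hs.abs.mul_left 2) fun x => by
    rw [Real.norm_eq_abs, abs_mul, abs_abs,
      abs_of_nonneg (sub_nonneg.2 (Real.cos_le_one (kdot m x)))]
    refine mul_le_mul_of_nonneg_right ?_ (abs_nonneg _)
    linarith [Real.neg_one_le_cos (kdot m x)]

/-- **(8.2.29)**: `|â(l) - â^{cos}(l,k)| = |Σ_x [1 - cos(k·x)] cos(l·x) a(x)| ≤ Σ_x [1 - cos(k·x)] |a(x)|`.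
[cite: HeydenreichVanDerHofstad2017, (8.2.29)] -/
theorem abs_cosFT_sub_cosCos_le (k l : Fin d → ℝ) :
    |cosFT a l - ∑' x, a x * (Real.cos (kdot l x) * Real.cos (kdot k x))| ≤
      ∑' x, (1 - Real.cos (kdot k x)) * |a x| := by
  have hk0 : ∀ x : Site d, 0 ≤ 1 - Real.cos (kdot k x) := fun x => sub_nonneg.2 (Real.cos_le_one _)
  have hk2 : ∀ x : Site d, 1 - Real.cos (kdot k x) ≤ 2 := fun x => by
    linarith [Real.neg_one_le_cos (kdot k x)]
  have hs1 : Summable fun x => a x * (Real.cos (kdot l x) * Real.cos (kdot k x)) :=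
    summable_mul_of_abs_le hs 1 fun x => by
      rw [abs_mul]
      exact mul_le_one₀ (Real.abs_cos_le_one _) (abs_nonneg _) (Real.abs_cos_le_one _)
  rw [cosFT, ← (summable_cos_kdot_mul hs l).tsum_sub hs1]
  have e : (fun x => Real.cos (kdot l x) * a x - a x * (Real.cos (kdot l x) * Real.cos (kdot k x))) =
      fun x => (Real.cos (kdot l x) * (1 - Real.cos (kdot k x))) * a x := funext fun x => by ring
  rw [e]
  refine abs_tsum_mul_le (fun x => ?_) ?_ (summable_one_sub_cos_mul_abs hs k)
  · rw [abs_mul, abs_of_nonneg (hk0 x)]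
    exact mul_le_of_le_one_left (hk0 x) (Real.abs_cos_le_one _)
  · have h := summable_mul_of_abs_le hs (g := fun x => Real.cos (kdot l x) * (1 - Real.cos (kdot k x)))
      2 (fun x => by
        rw [abs_mul, abs_of_nonneg (hk0 x)]
        calc |Real.cos (kdot l x)| * (1 - Real.cos (kdot k x)) ≤ 1 * (1 - Real.cos (kdot k x)) :=
              mul_le_mul_of_nonneg_right (Real.abs_cos_le_one _) (hk0 x)
          _ ≤ 2 := by rw [one_mul]; exact hk2 x)
    exact h.congr fun x => by ring

/-- **(8.2.30)**: `â^{sin}(l,k)² ≤ 4 Bₐ(l) Bₐ(k)`, i.e.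
`(Σ_x a(x) sin(l·x) sin(k·x))² ≤ 4 (Σ_x [1 - cos(l·x)]|a(x)|)(Σ_x [1 - cos(k·x)]|a(x)|)`
(Cauchy–Schwarz and `sin² = (1 - cos)(1 + cos) ≤ 2(1 - cos)`). [cite: HeydenreichVanDerHofstad2017, (8.2.30)] -/
theorem sinSin_sq_le (k l : Fin d → ℝ) :
    (∑' x, a x * (Real.sin (kdot l x) * Real.sin (kdot k x))) ^ 2 ≤
      4 * (∑' x, (1 - Real.cos (kdot l x)) * |a x|) * (∑' x, (1 - Real.cos (kdot k x)) * |a x|) := by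
  -- `|Σ a sin sin| ≤ Σ |a| |sin(l·x)| |sin(k·x)| ≤ √(Σ|a| sin²(l·x)) √(Σ |a| sin²(k·x))`
  have hB := fun m => summable_one_sub_cos_mul_abs hs m
  have hsq : ∀ m, Summable fun x => |a x| * Real.sin (kdot m x) ^ 2 := fun m =>
    Summable.of_norm_bounded hs.abs fun x => by
      rw [Real.norm_eq_abs, abs_mul, abs_abs, abs_of_nonneg (sq_nonneg (Real.sin (kdot m x)))]
      exact mul_le_of_le_one_right (abs_nonneg _) (by nlinarith [Real.sin_sq_le_one (kdot m x)])
  have hprod : Summable fun x => |a x| * (|Real.sin (kdot l x)| * |Real.sin (kdot k x)|) :=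
    Summable.of_norm_bounded hs.abs fun x => by
      rw [Real.norm_eq_abs, abs_mul, abs_abs, abs_mul, abs_abs, abs_abs]
      refine mul_le_of_le_one_right (abs_nonneg _) ?_
      exact mul_le_one₀ (Real.abs_sin_le_one _) (abs_nonneg _) (Real.abs_sin_le_one _)
  have h1 : |∑' x, a x * (Real.sin (kdot l x) * Real.sin (kdot k x))| ≤
      ∑' x, |a x| * (|Real.sin (kdot l x)| * |Real.sin (kdot k x)|) := by
    have hsum : Summable fun x => a x * (Real.sin (kdot l x) * Real.sin (kdot k x)) :=
      summable_mul_of_abs_le hs 1 fun x => by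
        rw [abs_mul]
        exact mul_le_one₀ (Real.abs_sin_le_one _) (abs_nonneg _) (Real.abs_sin_le_one _)
    have h := abs_tsum_mul_le (c := fun x => Real.sin (kdot l x) * Real.sin (kdot k x))
      (w := fun x => |Real.sin (kdot l x)| * |Real.sin (kdot k x)|) (f := a)
      (fun x => by rw [abs_mul]) (hsum.congr fun x => by ring) (hprod.congr fun x => by ring)
    calc |∑' x, a x * (Real.sin (kdot l x) * Real.sin (kdot k x))|
        = |∑' x, (Real.sin (kdot l x) * Real.sin (kdot k x)) * a x| := by
          congr 1; exact tsum_congr fun x => by ring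
      _ ≤ ∑' x, (|Real.sin (kdot l x)| * |Real.sin (kdot k x)|) * |a x| := h
      _ = ∑' x, |a x| * (|Real.sin (kdot l x)| * |Real.sin (kdot k x)|) := tsum_congr fun x => by ring
  have h2 := tsum_mul_abs_mul_abs_le (w := fun x => |a x|) (u := fun x => Real.sin (kdot l x))
    (v := fun x => Real.sin (kdot k x)) (fun x => abs_nonneg _) (hsq l) (hsq k) hprod
  -- `Σ |a| sin²(m·x) ≤ 2 Bₐ(m)`
  have h3 : ∀ m, ∑' x, |a x| * Real.sin (kdot m x) ^ 2 ≤ 2 * ∑' x, (1 - Real.cos (kdot m x)) * |a x| := by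
    intro m
    rw [← tsum_mul_left]
    refine Summable.tsum_le_tsum (fun x => ?_) (hsq m) ((hB m).mul_left 2)
    have : Real.sin (kdot m x) ^ 2 ≤ 2 * (1 - Real.cos (kdot m x)) := by
      nlinarith [Real.sin_sq_add_cos_sq (kdot m x), Real.cos_le_one (kdot m x),
        Real.neg_one_le_cos (kdot m x)]
    nlinarith [abs_nonneg (a x)]
  have hBl : 0 ≤ ∑' x, (1 - Real.cos (kdot l x)) * |a x| :=
    tsum_nonneg fun x => mul_nonneg (by linarith [Real.cos_le_one (kdot l x)]) (abs_nonneg _)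
  have hBk : 0 ≤ ∑' x, (1 - Real.cos (kdot k x)) * |a x| :=
    tsum_nonneg fun x => mul_nonneg (by linarith [Real.cos_le_one (kdot k x)]) (abs_nonneg _)
  have h4 : Real.sqrt (∑' x, |a x| * Real.sin (kdot l x) ^ 2) * Real.sqrt (∑' x, |a x| * Real.sin (kdot k x) ^ 2)
      ≤ Real.sqrt (2 * ∑' x, (1 - Real.cos (kdot l x)) * |a x|) *
        Real.sqrt (2 * ∑' x, (1 - Real.cos (kdot k x)) * |a x|) :=
    mul_le_mul (Real.sqrt_le_sqrt (h3 l)) (Real.sqrt_le_sqrt (h3 k)) (Real.sqrt_nonneg _)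
      (Real.sqrt_nonneg _)
  have h5 := (abs_le.1 (h1.trans (h2.trans h4)))
  have h6 : (∑' x, a x * (Real.sin (kdot l x) * Real.sin (kdot k x))) ^ 2 ≤
      (Real.sqrt (2 * ∑' x, (1 - Real.cos (kdot l x)) * |a x|) *
        Real.sqrt (2 * ∑' x, (1 - Real.cos (kdot k x)) * |a x|)) ^ 2 :=
    sq_le_sq' h5.1 h5.2
  calc _ ≤ _ := h6
    _ = 4 * (∑' x, (1 - Real.cos (kdot l x)) * |a x|) * (∑' x, (1 - Real.cos (kdot k x)) * |a x|) := by
        rw [mul_pow, Real.sq_sqrt (by positivity), Real.sq_sqrt (by positivity)]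
        ring

end CosFT

/-! ### Slade's lemma (HvdH Lemma 8.2) -/

/-- **The algebraic heart of Lemma 8.2** ((8.2.25)–(8.2.28)): for reals `â, â₋, â₊` with
`1 - â, 1 - â₋, 1 - â₊ ≠ 0` and `Â = 1/(1-â)` etc.,
`Â₋ + Â₊ - 2Â = -(Â₋ + Â₊) Â (â - (â₋ + â₊)/2) + 2 Â₋ Â Â₊ ((â₋ - â₊)/2)²`.
[cite: HeydenreichVanDerHofstad2017, (8.2.25)–(8.2.28)] -/
theorem secondDiff_inv_one_sub {x xm xp : ℝ} (hx : 1 - x ≠ 0) (hxm : 1 - xm ≠ 0) (hxp : 1 - xp ≠ 0) :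
    1 / (1 - xm) + 1 / (1 - xp) - 2 * (1 / (1 - x)) =
      -((1 / (1 - xm) + 1 / (1 - xp)) * (1 / (1 - x)) * (x - (xm + xp) / 2)) +
        2 * (1 / (1 - xm)) * (1 / (1 - x)) * (1 / (1 - xp)) * ((xm - xp) / 2) ^ 2 := by
  field_simp
  ring

/-- **HvdH Lemma 8.2 (Slade)**: let `a : ℤ^d → ℝ` be summable, `â = cosFT a`, and suppose
`1 - â > 0` at `l - k`, `l`, `l + k`; put `Â(m) = 1/(1 - â(m))` and
`Bₐ(m) = Σ_x [1 - cos(m·x)] |a(x)|` (`= |â|(0) - |â|(m)`). Then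
`|Â(l-k) + Â(l+k) - 2Â(l)| ≤ (Â(l-k) + Â(l+k)) Â(l) Bₐ(k) + 8 Â(l-k) Â(l) Â(l+k) Bₐ(l) Bₐ(k)`
((8.2.20); the printed symmetry assumption `a(x) = a(-x)` only serves to make the complex
transform real and is not needed for the cosine transform).
[cite: HeydenreichVanDerHofstad2017, Lemma 8.2 ((8.2.19)–(8.2.30))] -/
theorem slade_lemma82 {a : Site d → ℝ} (hs : Summable a) (k l : Fin d → ℝ)
    (hl : 0 < 1 - cosFT a l) (hm : 0 < 1 - cosFT a (l - k)) (hp : 0 < 1 - cosFT a (l + k)) :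
    |1 / (1 - cosFT a (l - k)) + 1 / (1 - cosFT a (l + k)) - 2 * (1 / (1 - cosFT a l))| ≤
      (1 / (1 - cosFT a (l - k)) + 1 / (1 - cosFT a (l + k))) * (1 / (1 - cosFT a l)) *
          (∑' x, (1 - Real.cos (kdot k x)) * |a x|) +
        8 * (1 / (1 - cosFT a (l - k))) * (1 / (1 - cosFT a l)) * (1 / (1 - cosFT a (l + k))) *
          (∑' x, (1 - Real.cos (kdot l x)) * |a x|) * (∑' x, (1 - Real.cos (kdot k x)) * |a x|) := by
  set Am := 1 / (1 - cosFT a (l - k)) with hAm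
  set Ap := 1 / (1 - cosFT a (l + k)) with hAp
  set A := 1 / (1 - cosFT a l) with hA
  set Bk := ∑' x, (1 - Real.cos (kdot k x)) * |a x| with hBk
  set Bl := ∑' x, (1 - Real.cos (kdot l x)) * |a x| with hBl
  have hAm0 : 0 < Am := one_div_pos.2 hm
  have hAp0 : 0 < Ap := one_div_pos.2 hp
  have hA0 : 0 < A := one_div_pos.2 hl
  have hBk0 : 0 ≤ Bk := tsum_nonneg fun x => mul_nonneg (by linarith [Real.cos_le_one (kdot k x)]) (abs_nonneg _)
  rw [secondDiff_inv_one_sub hl.ne' hm.ne' hp.ne']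
  -- `|â - â^{cos}| ≤ Bₐ(k)` and `(â^{sin})² ≤ 4 Bₐ(l) Bₐ(k)`
  have hcos : |cosFT a l - (cosFT a (l - k) + cosFT a (l + k)) / 2| ≤ Bk := by
    rw [cosFT_sub_add_cosFT_add hs k l, mul_div_cancel_left₀ _ (two_ne_zero)]
    exact abs_cosFT_sub_cosCos_le hs k l
  have hsin : ((cosFT a (l - k) - cosFT a (l + k)) / 2) ^ 2 ≤ 4 * Bl * Bk := by
    rw [cosFT_sub_sub_cosFT_add hs k l, mul_div_cancel_left₀ _ (two_ne_zero)]
    exact sinSin_sq_le hs k l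
  calc |-((Am + Ap) * A * (cosFT a l - (cosFT a (l - k) + cosFT a (l + k)) / 2)) +
          2 * Am * A * Ap * ((cosFT a (l - k) - cosFT a (l + k)) / 2) ^ 2|
      ≤ |(Am + Ap) * A * (cosFT a l - (cosFT a (l - k) + cosFT a (l + k)) / 2)| +
          |2 * Am * A * Ap * ((cosFT a (l - k) - cosFT a (l + k)) / 2) ^ 2| := by
        refine (abs_add_le _ _).trans ?_
        rw [abs_neg]
    _ = (Am + Ap) * A * |cosFT a l - (cosFT a (l - k) + cosFT a (l + k)) / 2| +
          2 * Am * A * Ap * ((cosFT a (l - k) - cosFT a (l + k)) / 2) ^ 2 := by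
        have h1 : 0 < (Am + Ap) * A := by positivity
        have h2 : 0 ≤ 2 * Am * A * Ap * ((cosFT a (l - k) - cosFT a (l + k)) / 2) ^ 2 := by
          positivity
        rw [abs_mul ((Am + Ap) * A), abs_of_pos h1, abs_of_nonneg h2]
    _ ≤ (Am + Ap) * A * Bk + 2 * Am * A * Ap * (4 * Bl * Bk) :=
        add_le_add (mul_le_mul_of_nonneg_left hcos (by positivity))
          (mul_le_mul_of_nonneg_left hsin (by positivity))
    _ = (Am + Ap) * A * Bk + 8 * Am * A * Ap * Bl * Bk := by ring

/-! ### Reduction of momenta to the Brillouin zone -/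

/-- **Every momentum has a representative in `[-π,π]^d` with the same cosines**: there is
`m' ∈ cube d` with `cos(m'·x) = cos(m·x)` for all `x ∈ ℤ^d` and `cos(m'ⱼ) = cos(mⱼ)` for all `j`
(reduce each coordinate mod `2π` into `[-π, π)`). [folklore] -/
theorem exists_mem_cube_cos_kdot_eq (m : Fin d → ℝ) :
    ∃ m' : Fin d → ℝ, m' ∈ cube d ∧ (∀ x : Site d, Real.cos (kdot m' x) = Real.cos (kdot m x)) ∧
      (∀ j, Real.cos (m' j) = Real.cos (m j)) := by
  have h2π : (0 : ℝ) < 2 * Real.pi := by positivity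
  set m' : Fin d → ℝ := fun j => toIcoMod h2π (-Real.pi) (m j) with hm'
  set n : Fin d → ℤ := fun j => toIcoDiv h2π (-Real.pi) (m j) with hn
  have hdecomp : ∀ j, m j = m' j + n j * (2 * Real.pi) := fun j => by
    have h := toIcoMod_add_toIcoDiv_zsmul h2π (-Real.pi) (m j)
    rw [zsmul_eq_mul] at h
    rw [hm', hn]
    exact h.symm
  refine ⟨m', ?_, fun x => ?_, fun j => ?_⟩
  · rw [cube, Set.mem_univ_pi]
    intro j
    have h := toIcoMod_mem_Ico h2π (-Real.pi) (m j)
    exact ⟨h.1, by linarith [h.2]⟩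
  · have e : kdot m x = kdot m' x + (∑ j, (n j : ℝ) * (x j : ℝ)) * (2 * Real.pi) := by
      simp only [kdot]
      rw [Finset.sum_mul, ← Finset.sum_add_distrib]
      refine Finset.sum_congr rfl fun j _ => ?_
      rw [hdecomp j]
      ring
    have e2 : (∑ j, (n j : ℝ) * (x j : ℝ)) = ((∑ j, n j * x j : ℤ) : ℝ) := by
      push_cast
      ring
    rw [e, e2, Real.cos_add_int_mul_two_pi]
  · rw [hdecomp j, Real.cos_add_int_mul_two_pi]

/-- Consequently every cosine transform, `τ̂_p` and `D̂` take at `m` a value taken on the cube: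
`∃ m' ∈ cube d`, `cosFT f m' = cosFT f m` for ALL `f`, and `D̂(m') = D̂(m)`. [folklore] -/
theorem exists_mem_cube_cosFT_eq (m : Fin d → ℝ) :
    ∃ m' : Fin d → ℝ, m' ∈ cube d ∧ (∀ f : Site d → ℝ, cosFT f m' = cosFT f m) ∧
      Dhat d m' = Dhat d m := by
  obtain ⟨m', hm', hcos, hcosj⟩ := exists_mem_cube_cos_kdot_eq m
  refine ⟨m', hm', fun f => ?_, ?_⟩
  · simp only [cosFT, hcos]
  · simp only [Dhat, hcosj]

/-- **The bootstrap bound off the Brillouin zone**: for `d ≥ 2`, `p < p_c` and EVERY `m ∈ ℝ^d`,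
`τ̂_p(m)/Ĉ_{λ_p}(m) ≤ f₂(p)` (the supremum in `f₂` runs over the cube; reduce `m` to it).
[cite: HeydenreichVanDerHofstad2017, (8.2.7)] -/
theorem tauHat_div_Chat_le_bootF2 (hd : 2 ≤ d) (p : unitInterval)
    (hp : (p : ℝ) < criticalProb (zdGraph d) (0 : Site d)) (m : Fin d → ℝ) :
    tauHat d p m / Chat d (lam d p) m ≤ bootF2 d p := by
  obtain ⟨m', hm', hcos, hD⟩ := exists_mem_cube_cosFT_eq m
  have h1 := le_ciSup (bddAbove_range_bootF2 hd p hp) ⟨m', hm'⟩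
  have h2 : tauHat d p m' / Chat d (lam d p) m' ≤ bootF2 d p := h1
  rwa [tauHat_eq_cosFT, hcos, Chat, hD, ← Chat, ← tauHat_eq_cosFT] at h2

end Literature.Barriers.CriticalPhenomena

end
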